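import Summits.NavierStokesRegularity.FluidComputer.ClayBlowup
import Summits.NavierStokesRegularity.FluidComputer.DesignedBlowupEnergyClass
import Summits.NavierStokesRegularity.FluidComputer.ForcedContinuationPieces
import Literature.Analysis.FluidPDE.TaoH1LocalExistenceForcedHolds
import HarnessLib

/-!
# The finite-energy classical evolution of Clay data with a Clay force, I: pieces

Cell `ns-blowup`, seat `ns-blowup-ecbridge-2` (g5; the E–C endpoint theory seat). LABEL: E–C typing
(KERNEL — no named fact). WHAT THIS IS NOT: not Navier–Stokes evidence — local existence,
uniqueness and energy bookkeeping for the forced system from GIVEN Clay data; no blow-up is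
constructed or asserted. Companion memo: `run/shared/lean/pub/ns-blowup/ecbridge2/ECBRIDGE-2-MEMO-4.md`.

## Content (the ingredients of the maximal finite-energy evolution)

Fix `ν`, a Clay force `f` (smooth on `[0, ∞) × ℝ³` with Fefferman's decay (5)) and a datum `u₀`.
A **piece** is a finite-energy classical solution `(v, q)` of the forced system on a closed slab
`[0, τ] × ℝ³`, `τ > 0`, with `v 0 = u₀` (`ClayEvolution.Piece ν f u₀`). This file proves:

* `Piece.eq` — two pieces agree on their common slab (W14, the tree THEOREM
  `tao_unconditional_uniqueness_velocity_forced_holds`, for a Clay datum);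
* `Piece.nonempty_of_clay` — for `ν > 0` and a Clay datum there IS a piece (Tao 2013, Thm. 5.4 with
  force = the tree THEOREM `tao2011_smooth_local_existence_forced_holds`, lifespan from the `H¹`
  sizes of `u₀` and `f`);
* `clayForce_lintegral_sqrt_energy_le` — a Clay force is `L¹_t L²_x` on `[0, ∞)`: ONE finite `F`
  bounds `∫₀ᵀ ‖f(t)‖_{L²} dt` for every `T` (decay (5) with `K = 4` splits as
  `(1 + t)⁻² (1 + ‖x‖)⁻²`; Japanese bracket integrable in `ℝ³` and in `ℝ`);
* `Piece.energy_le_uniform` — ONE finite `E` bounds `∫|v(t)|²` for every piece and every `t` of its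
  slab (Tao 2013, Lemma 8.1 with force = the tree THEOREM
  `tao2011_forced_finiteEnergy_energyBound_holds`, whose right-hand side
  `C (‖u₀‖₂ + ‖f‖_{L¹_t L²_x[0,τ]})²` is now `τ`-independent).

References: T. Tao, Anal. PDE 6 (2013) = arXiv:1108.1165, Thm. 5.4, Lemma 8.1, Cor. 11.4
[cite: Tao2011, Thm. 5.4 (ii)+(iv)]; C. L. Fefferman, Clay problem description, (4)–(7)
[cite: FeffermanClay2006, (5)]; J. Leray, Acta Math. 63 (1934), §32 [cite: Leray1934, §32].
-/

noncomputable section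

namespace Summit.NavierStokesRegularity.FluidComputer

open Set MeasureTheory Filter Topology Function
open scoped ENNReal ContDiff NNReal
open Literature.Analysis.FluidPDE
open Summit.NavierStokesRegularity.NavierStokesRegularity
open Summit.NavierStokesRegularity.NavierStokesRegularity.Theorems
open Summit.NavierStokesRegularity.FluidComputer.PalasekTowerClayBridge

namespace ClayEvolution

/-! ## §1 Pieces -/

/-- **A piece of the finite-energy classical evolution** of the datum `u₀` under the force `f` at
viscosity `ν`: a classical solution `(v, q)` of the forced Navier–Stokes system on the closed slab
`[0, τ] × ℝ³`, `τ > 0`, with `v 0 = u₀` and energy bounded on the slab (Leray's class).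
[cite: Leray1934, §32] [cite: Tao2011, Def. 1.1] -/
structure Piece (ν : ℝ) (f : ℝ → EuclideanSpace ℝ (Fin 3) → EuclideanSpace ℝ (Fin 3))
    (u₀ : EuclideanSpace ℝ (Fin 3) → EuclideanSpace ℝ (Fin 3)) where
  /-- the length of the slab -/
  τ : ℝ
  τ_pos : 0 < τ
  /-- velocity -/
  v : ℝ → EuclideanSpace ℝ (Fin 3) → EuclideanSpace ℝ (Fin 3)
  /-- pressure -/
  q : ℝ → EuclideanSpace ℝ (Fin 3) → ℝ
  /-- exact classical forced Navier–Stokes on `[0, τ]` -/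
  classical : IsClassicalNSSolutionOn (Icc 0 τ) ν f v q
  /-- the datum -/
  initial : v 0 = u₀
  /-- finite energy on the slab -/
  energy : ∃ C : ℝ≥0∞, C < ⊤ ∧ ∀ t ∈ Icc 0 τ, ∫⁻ x, ‖v t x‖ₑ ^ 2 ≤ C

variable {ν : ℝ} {f : ℝ → EuclideanSpace ℝ (Fin 3) → EuclideanSpace ℝ (Fin 3)}
  {u₀ : EuclideanSpace ℝ (Fin 3) → EuclideanSpace ℝ (Fin 3)}

namespace Piece

/-- A piece restricted to a shorter closed slab `[0, τ']`, `0 < τ' ≤ τ`, is classical there.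
[folklore] -/
theorem classical_of_le (P : Piece ν f u₀) {τ' : ℝ} (hτ'0 : 0 < τ') (hτ' : τ' ≤ P.τ) :
    IsClassicalNSSolutionOn (Icc 0 τ') ν f P.v P.q :=
  P.classical.mono (Icc_subset_Icc le_rfl hτ') (uniqueDiffOn_Icc hτ'0)

/-- The energy bound of a piece on a shorter slab. [folklore] -/
theorem energy_of_le (P : Piece ν f u₀) {τ' : ℝ} (hτ' : τ' ≤ P.τ) :
    ∃ C : ℝ≥0∞, C < ⊤ ∧ ∀ t ∈ Icc 0 τ', ∫⁻ x, ‖P.v t x‖ₑ ^ 2 ≤ C := by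
  obtain ⟨C, hC, hb⟩ := P.energy
  exact ⟨C, hC, fun t ht => hb t ⟨ht.1, ht.2.trans hτ'⟩⟩

/-- **Two pieces agree on their common slab** (Clay datum; W14 = the tree theorem
`tao_unconditional_uniqueness_velocity_forced_holds`). [cite: Tao2011, Cor. 11.4] -/
theorem eq (hν : 0 < ν) (hs : IsSmoothOnHalfSpace f) (hd : HasRapidSpaceTimeDecay f)
    (hC1 : ContDiff ℝ 1 u₀) (hdec : HasRapidSpatialDecay u₀) (P Q : Piece ν f u₀) :
    ∀ t ∈ Icc 0 (min P.τ Q.τ), P.v t = Q.v t := by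
  obtain ⟨hL2, hH1⟩ := ClayUniqueness.memLp_two_of_rapidDecay hdec hC1
  have hm : 0 < min P.τ Q.τ := lt_min P.τ_pos Q.τ_pos
  exact tao_unconditional_uniqueness_velocity_forced_holds ν (min P.τ Q.τ) hν hm u₀ hL2 hH1 f hs hd
    P.v Q.v P.q Q.q (P.classical_of_le hm (min_le_left _ _)) (Q.classical_of_le hm (min_le_right _ _))
    P.initial Q.initial (P.energy_of_le (min_le_left _ _)) (Q.energy_of_le (min_le_right _ _))

/-- Two pieces agree at every common time `0 ≤ t`, `t ≤ P.τ`, `t ≤ Q.τ`. [cite: Tao2011, Cor. 11.4] -/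
theorem eq_of_le (hν : 0 < ν) (hs : IsSmoothOnHalfSpace f) (hd : HasRapidSpaceTimeDecay f)
    (hC1 : ContDiff ℝ 1 u₀) (hdec : HasRapidSpatialDecay u₀) (P Q : Piece ν f u₀) {t : ℝ}
    (ht0 : 0 ≤ t) (htP : t ≤ P.τ) (htQ : t ≤ Q.τ) : P.v t = Q.v t :=
  P.eq hν hs hd hC1 hdec Q t ⟨ht0, le_min htP htQ⟩

/-- **A finite-energy classical solution on a half-open slab `[0, T')` restricts to a piece on every
`[0, τ]`, `0 < τ < T'`.** [folklore] -/
def ofIco {T' : ℝ} {v : ℝ → EuclideanSpace ℝ (Fin 3) → EuclideanSpace ℝ (Fin 3)}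
    {q : ℝ → EuclideanSpace ℝ (Fin 3) → ℝ} (hv : IsClassicalNSSolutionOn (Ico 0 T') ν f v q)
    (h0 : v 0 = u₀)
    (hE : ∀ T'', T'' < T' → ∃ C : ℝ≥0∞, C < ⊤ ∧ ∀ t ∈ Icc 0 T'', ∫⁻ x, ‖v t x‖ₑ ^ 2 ≤ C)
    {τ : ℝ} (hτ0 : 0 < τ) (hτ : τ < T') : Piece ν f u₀ where
  τ := τ
  τ_pos := hτ0
  v := v
  q := q
  classical := hv.mono (Icc_subset_Ico_right hτ) (uniqueDiffOn_Icc hτ0)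
  initial := h0
  energy := hE τ hτ

end Piece

/-! ## §2 The first piece: forced local existence from a Clay datum -/

/-- `∫ ‖w‖² = ∫ ‖D⁰ w‖²`. [folklore] -/
private theorem lintegral_enorm_sq_eq_iteratedFDeriv_zero
    (w : EuclideanSpace ℝ (Fin 3) → EuclideanSpace ℝ (Fin 3)) :
    ∫⁻ x, ‖w x‖ₑ ^ 2 = ∫⁻ x, ‖iteratedFDeriv ℝ 0 w x‖ₑ ^ 2 :=
  lintegral_congr fun x => by rw [← ofReal_norm, ← ofReal_norm, norm_iteratedFDeriv_zero]

/-- The energy bound of a field in Tao's class on a slab (the `n = 0` Sobolev bound). [folklore] -/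
theorem energy_of_hasBoundedSobolevNormsOn {S : Set ℝ}
    {w : ℝ → EuclideanSpace ℝ (Fin 3) → EuclideanSpace ℝ (Fin 3)}
    (hw : HasBoundedSobolevNormsOn S w) :
    ∃ C : ℝ≥0∞, C < ⊤ ∧ ∀ t ∈ S, ∫⁻ x, ‖w t x‖ₑ ^ 2 ≤ C := by
  obtain ⟨C, hC⟩ := hw 0
  exact ⟨C, ENNReal.coe_lt_top, fun t ht => by
    rw [lintegral_enorm_sq_eq_iteratedFDeriv_zero]; exact hC t ht⟩

/-- **There is a piece** (`ν > 0`, Clay datum, Clay force): Tao's forced local existence theorem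
(tree theorem `tao2011_smooth_local_existence_forced_holds`) from the `H^∞` datum `u₀`, with the
lifespan `h = min(1, c ν³/(A + B + 1)⁴)` read off the `H¹` size `A` of `u₀` and the uniform `H¹`
size `B` of the slices of `f`. [cite: Tao2011, Thm. 5.4 (ii)+(iv)] -/
theorem Piece.nonempty_of_clay (hν : 0 < ν) (hu₀ : ContDiff ℝ ∞ u₀)
    (hdiv : VectorCalculus.IsDivFree u₀) (hdec : HasRapidSpatialDecay u₀)
    (hs : IsSmoothOnHalfSpace f) (hd : HasRapidSpaceTimeDecay f) : Nonempty (Piece ν f u₀) := by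
  obtain ⟨c, hc, hloc⟩ := tao2011_smooth_local_existence_forced_holds
  obtain ⟨C₀, C₁, B, hB0, -, -, hBf⟩ := ForcedContinuation.exists_force_slice_bounds hs hd
  -- `H^∞` datum, energy and enstrophy of the datum
  have hHinf : ∀ m : ℕ, ∫⁻ x, ‖iteratedFDeriv ℝ m u₀ x‖ₑ ^ 2 < ⊤ := fun m =>
    hdec.lintegral_enorm_iteratedFDeriv_sq_lt_top (μ := (volume : Measure _)) m
  set E₀ : ℝ≥0∞ := ∫⁻ x, ‖u₀ x‖ₑ ^ 2 with hE₀
  have hE₀t : E₀ < ⊤ := by rw [hE₀, lintegral_enorm_sq_eq_iteratedFDeriv_zero]; exact hHinf 0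
  set K₀ : ℝ≥0∞ := ∫⁻ x, ENNReal.ofReal (frobeniusNormSq (fderiv ℝ u₀ x)) with hK₀
  have hK₀t : K₀ < ⊤ :=
    (lintegral_frobeniusNormSq_le_three_mul_iteratedFDeriv_one u₀).trans_lt
      (ENNReal.mul_lt_top (by simp) (hHinf 1))
  set A : ℝ := Real.sqrt (E₀ + K₀).toReal with hA
  have hA0 : 0 ≤ A := Real.sqrt_nonneg _
  have hA2 : ENNReal.ofReal (A ^ 2) = E₀ + K₀ := by
    rw [hA, Real.sq_sqrt ENNReal.toReal_nonneg, ENNReal.ofReal_toReal]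
    exact (ENNReal.add_lt_top.2 ⟨hE₀t, hK₀t⟩).ne
  -- the lifespan
  set h : ℝ := min 1 (c * ν ^ 3 / (A + B + 1) ^ 4) with hh
  have hh1 : h ≤ 1 := min_le_left _ _
  have hhc : h ≤ c * ν ^ 3 / (A + B + 1) ^ 4 := min_le_right _ _
  have hhpos : 0 < h := lt_min one_pos (by positivity)
  have hsmall : (A + B * h) ^ 4 * h ≤ c * ν ^ 3 := by
    have h1 : A + B * h ≤ A + B + 1 := by nlinarith
    have h2 : 0 ≤ A + B * h := by positivity
    calc (A + B * h) ^ 4 * h ≤ (A + B + 1) ^ 4 * h :=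
          mul_le_mul_of_nonneg_right (pow_le_pow_left₀ h2 h1 4) hhpos.le
      _ ≤ (A + B + 1) ^ 4 * (c * ν ^ 3 / (A + B + 1) ^ 4) :=
          mul_le_mul_of_nonneg_left hhc (by positivity)
      _ = c * ν ^ 3 := by field_simp
  have hdat : (∫⁻ x, ‖u₀ x‖ₑ ^ 2) +
      (∫⁻ x, ENNReal.ofReal (frobeniusNormSq (fderiv ℝ u₀ x))) ≤ ENNReal.ofReal (A ^ 2) := by
    rw [hA2]
  have hfB : ∀ t ∈ Icc 0 h, (∫⁻ x, ‖f t x‖ₑ ^ 2) +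
      (∫⁻ x, ENNReal.ofReal (frobeniusNormSq (fderiv ℝ (f t) x))) ≤ ENNReal.ofReal (B ^ 2) :=
    fun t ht => hBf t ht.1
  obtain ⟨w, q, hw, hw0, hwS, -, -, -⟩ := hloc hν hhpos hu₀ hdiv hHinf (hs.isSmoothSpaceTimeOn_Icc h)
    (hd.hasUniformRapidDecayOn_Icc hs hhpos) hA0 hB0 hdat hfB hsmall
  exact ⟨⟨h, hhpos, w, q, hw, hw0, energy_of_hasBoundedSobolevNormsOn hwS⟩⟩

/-! ## §3 A Clay force is `L¹_t L²_x` on `[0, ∞)` -/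

/-- `(1 + a + b)² ≥ (1 + a)(1 + b)` for `a, b ≥ 0`. [folklore] -/
theorem one_add_add_sq_ge {a b : ℝ} (ha : 0 ≤ a) (hb : 0 ≤ b) :
    (1 + b) * (1 + a) ≤ (1 + a + b) ^ 2 := by nlinarith

/-- **Pointwise split of Fefferman's decay (5) at order zero**: a Clay force obeys
`‖f(t, x)‖ ≤ C (1 + t)⁻² (1 + ‖x‖)⁻²` for `t ≥ 0` (weight `K = 4`, then
`(1 + ‖x‖ + t)⁴ ≥ (1 + t)²(1 + ‖x‖)²`). [cite: FeffermanClay2006, (5)] -/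
theorem clayForce_norm_le_split (hd : HasRapidSpaceTimeDecay f) :
    ∃ C : ℝ, 0 ≤ C ∧ ∀ t, 0 ≤ t → ∀ x : EuclideanSpace ℝ (Fin 3),
      ‖f t x‖ ≤ C * (((1 + t) ^ 2)⁻¹ * ((1 + ‖x‖) ^ 2)⁻¹) := by
  obtain ⟨C, hC⟩ := hd 0 4
  have hC0 : 0 ≤ C := by
    have h := hC 0 le_rfl 0
    exact le_trans (mul_nonneg (by positivity) (norm_nonneg _)) h
  refine ⟨C, hC0, fun t ht x => ?_⟩
  have h := hC t ht x
  rw [norm_iteratedFDerivWithin_zero, uncurry_apply_pair] at h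
  have hpos : 0 < (1 + ‖x‖ + t) ^ 4 := by positivity
  have hle : ‖f t x‖ ≤ C / (1 + ‖x‖ + t) ^ 4 := by
    rw [le_div_iff₀ hpos, mul_comm]; exact h
  have hsq : (1 + t) ^ 2 * (1 + ‖x‖) ^ 2 ≤ (1 + ‖x‖ + t) ^ 4 := by
    have h1 := one_add_add_sq_ge (norm_nonneg x) ht
    have h2 : 0 ≤ (1 + t) * (1 + ‖x‖) := by positivity
    calc (1 + t) ^ 2 * (1 + ‖x‖) ^ 2 = ((1 + t) * (1 + ‖x‖)) ^ 2 := by ring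
      _ ≤ ((1 + ‖x‖ + t) ^ 2) ^ 2 := pow_le_pow_left₀ h2 h1 2
      _ = (1 + ‖x‖ + t) ^ 4 := by ring
  have hprod : 0 < (1 + t) ^ 2 * (1 + ‖x‖) ^ 2 := by positivity
  calc ‖f t x‖ ≤ C / (1 + ‖x‖ + t) ^ 4 := hle
    _ ≤ C / ((1 + t) ^ 2 * (1 + ‖x‖) ^ 2) := div_le_div_of_nonneg_left hC0 hprod hsq
    _ = C * (((1 + t) ^ 2)⁻¹ * ((1 + ‖x‖) ^ 2)⁻¹) := by rw [div_eq_mul_inv, mul_inv]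

/-- The Japanese bracket `(1 + ‖x‖)⁻⁴` is integrable on `ℝ³` (Mathlib `finite_integral_one_add_norm`,
`3 < 4`), in the form `∫ ((1 + ‖x‖)²)⁻¹² < ∞` used below. [folklore] -/
theorem lintegral_inv_one_add_norm_sq_sq_lt_top :
    ∫⁻ x : EuclideanSpace ℝ (Fin 3), ENNReal.ofReal ((((1 + ‖x‖) ^ 2)⁻¹) ^ 2) < ⊤ := by
  have h3 : (Module.finrank ℝ (EuclideanSpace ℝ (Fin 3)) : ℝ) < 4 := by
    rw [finrank_euclideanSpace, Fintype.card_fin]; norm_num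
  have h := finite_integral_one_add_norm (E := EuclideanSpace ℝ (Fin 3)) (μ := volume) h3
  refine lt_of_le_of_lt (le_of_eq (lintegral_congr fun x => ?_)) h
  congr 1
  have hx : 0 < 1 + ‖x‖ := by positivity
  rw [Real.rpow_neg hx.le, show (4 : ℝ) = ((4 : ℕ) : ℝ) by norm_num, Real.rpow_natCast, ← inv_pow,
    ← inv_pow, ← pow_mul]

/-- The one-dimensional Japanese bracket `(1 + |t|)⁻²` is integrable on `ℝ`, in the form
`∫ ((1 + ‖t‖)²)⁻¹ < ∞`. [folklore] -/
theorem lintegral_inv_one_add_abs_sq_lt_top :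
    ∫⁻ t : ℝ, ENNReal.ofReal (((1 + ‖t‖) ^ 2)⁻¹) < ⊤ := by
  have h1 : (Module.finrank ℝ ℝ : ℝ) < 2 := by rw [Module.finrank_self]; norm_num
  have h := finite_integral_one_add_norm (E := ℝ) (μ := volume) h1
  refine lt_of_le_of_lt (le_of_eq (lintegral_congr fun t => ?_)) h
  congr 1
  have ht : 0 < 1 + ‖t‖ := by positivity
  rw [Real.rpow_neg ht.le, show (2 : ℝ) = ((2 : ℕ) : ℝ) by norm_num, Real.rpow_natCast]

/-- **A Clay force is `L¹_t L²_x` on the whole half-line**: ONE finite `F` with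
`∫_{[0,T]} (∫ ‖f(t)‖²)^{1/2} dt ≤ F` for EVERY `T` (the quantity `‖f‖_{L¹_t L²_x}` of Tao's energy
`E(u₀, f, T)`, Lemma 8.1, bounded independently of `T`). [cite: FeffermanClay2006, (5)]
[cite: Tao2011, Lemma 8.1] -/
theorem clayForce_lintegral_sqrt_energy_le (hd : HasRapidSpaceTimeDecay f) :
    ∃ F : ℝ≥0∞, F < ⊤ ∧ ∀ T : ℝ,
      ∫⁻ t in Icc 0 T, (∫⁻ x, ‖f t x‖ₑ ^ 2) ^ (1 / 2 : ℝ) ≤ F := by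
  obtain ⟨C, hC0, hC⟩ := clayForce_norm_le_split hd
  set I : ℝ≥0∞ := ∫⁻ x : EuclideanSpace ℝ (Fin 3), ENNReal.ofReal ((((1 + ‖x‖) ^ 2)⁻¹) ^ 2) with hI
  have hIt : I < ⊤ := lintegral_inv_one_add_norm_sq_sq_lt_top
  set L : ℝ≥0∞ := ∫⁻ t : ℝ, ENNReal.ofReal (((1 + ‖t‖) ^ 2)⁻¹) with hL
  have hLt : L < ⊤ := lintegral_inv_one_add_abs_sq_lt_top
  -- slice bound: `∫ ‖f t‖² ≤ (C (1+t)⁻²)² · I`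
  have hslice : ∀ t, 0 ≤ t →
      ∫⁻ x, ‖f t x‖ₑ ^ 2 ≤ ENNReal.ofReal ((C * ((1 + t) ^ 2)⁻¹) ^ 2) * I := by
    intro t ht
    have hpt : ∀ x : EuclideanSpace ℝ (Fin 3), ‖f t x‖ₑ ^ 2 ≤
        ENNReal.ofReal ((C * ((1 + t) ^ 2)⁻¹) ^ 2) * ENNReal.ofReal ((((1 + ‖x‖) ^ 2)⁻¹) ^ 2) := by
      intro x
      have h1 : ‖f t x‖ ≤ (C * ((1 + t) ^ 2)⁻¹) * ((1 + ‖x‖) ^ 2)⁻¹ := by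
        rw [mul_assoc]; exact hC t ht x
      have h0 : 0 ≤ (C * ((1 + t) ^ 2)⁻¹) * ((1 + ‖x‖) ^ 2)⁻¹ := by positivity
      have h2 : ‖f t x‖ ^ 2 ≤ (C * ((1 + t) ^ 2)⁻¹) ^ 2 * (((1 + ‖x‖) ^ 2)⁻¹) ^ 2 := by
        rw [← mul_pow]; exact pow_le_pow_left₀ (norm_nonneg _) h1 2
      rw [← ofReal_norm, ← ENNReal.ofReal_pow (norm_nonneg _), ← ENNReal.ofReal_mul (sq_nonneg _)]
      exact ENNReal.ofReal_le_ofReal h2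
    calc ∫⁻ x, ‖f t x‖ₑ ^ 2
        ≤ ∫⁻ x, ENNReal.ofReal ((C * ((1 + t) ^ 2)⁻¹) ^ 2) *
            ENNReal.ofReal ((((1 + ‖x‖) ^ 2)⁻¹) ^ 2) := lintegral_mono hpt
      _ = ENNReal.ofReal ((C * ((1 + t) ^ 2)⁻¹) ^ 2) * I :=
          lintegral_const_mul' _ _ ENNReal.ofReal_ne_top
  -- square root of the slice bound
  have hsqrt : ∀ t, 0 ≤ t →
      (∫⁻ x, ‖f t x‖ₑ ^ 2) ^ (1 / 2 : ℝ) ≤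
        ENNReal.ofReal (C * ((1 + ‖t‖) ^ 2)⁻¹) * I ^ (1 / 2 : ℝ) := by
    intro t ht
    have hnn : 0 ≤ C * ((1 + t) ^ 2)⁻¹ := by positivity
    have habs : ‖t‖ = t := by rw [Real.norm_eq_abs, abs_of_nonneg ht]
    calc (∫⁻ x, ‖f t x‖ₑ ^ 2) ^ (1 / 2 : ℝ)
        ≤ (ENNReal.ofReal ((C * ((1 + t) ^ 2)⁻¹) ^ 2) * I) ^ (1 / 2 : ℝ) :=
          ENNReal.rpow_le_rpow (hslice t ht) (by norm_num)
      _ = ENNReal.ofReal (C * ((1 + t) ^ 2)⁻¹) * I ^ (1 / 2 : ℝ) := by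
          rw [ENNReal.mul_rpow_of_nonneg _ _ (by norm_num : (0 : ℝ) ≤ 1 / 2),
            ENNReal.ofReal_pow hnn, ← ENNReal.rpow_natCast, ← ENNReal.rpow_mul]
          norm_num
      _ = ENNReal.ofReal (C * ((1 + ‖t‖) ^ 2)⁻¹) * I ^ (1 / 2 : ℝ) := by rw [habs]
  refine ⟨ENNReal.ofReal C * L * I ^ (1 / 2 : ℝ), ?_, fun T => ?_⟩
  · exact ENNReal.mul_lt_top (ENNReal.mul_lt_top ENNReal.ofReal_lt_top hLt)
      (ENNReal.rpow_lt_top_of_nonneg (by norm_num) hIt.ne)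
  calc ∫⁻ t in Icc 0 T, (∫⁻ x, ‖f t x‖ₑ ^ 2) ^ (1 / 2 : ℝ)
      ≤ ∫⁻ t in Icc 0 T, ENNReal.ofReal (C * ((1 + ‖t‖) ^ 2)⁻¹) * I ^ (1 / 2 : ℝ) :=
        setLIntegral_mono' measurableSet_Icc fun t ht => hsqrt t ht.1
    _ ≤ ∫⁻ t, ENNReal.ofReal (C * ((1 + ‖t‖) ^ 2)⁻¹) * I ^ (1 / 2 : ℝ) :=
        setLIntegral_le_lintegral _ _
    _ = (∫⁻ t, ENNReal.ofReal (C * ((1 + ‖t‖) ^ 2)⁻¹)) * I ^ (1 / 2 : ℝ) :=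
        lintegral_mul_const' _ _ (ENNReal.rpow_lt_top_of_nonneg (by norm_num) hIt.ne).ne
    _ = ENNReal.ofReal C * L * I ^ (1 / 2 : ℝ) := by
        congr 1
        rw [hL, ← lintegral_const_mul' _ _ ENNReal.ofReal_ne_top]
        refine lintegral_congr fun t => ?_
        rw [← ENNReal.ofReal_mul hC0]

/-! ## §4 ONE energy bound for all pieces -/

/-- **Uniform energy bound for the pieces of the evolution of a Clay datum under a Clay force**
(`ν > 0`): there is ONE finite `E` with `∫ |v(t)|² ≤ E` for every piece `(v, q)` on `[0, τ]` and
every `t ∈ [0, τ]` — Tao's Lemma 8.1 with force (tree theorem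
`tao2011_forced_finiteEnergy_energyBound_holds`) on the slab, with the `L¹_t L²_x` size of the force
bounded independently of `τ` (`clayForce_lintegral_sqrt_energy_le`). [cite: Tao2011, Lemma 8.1]
[cite: FeffermanClay2006, (5) (7)] -/
theorem Piece.energy_le_uniform (hν : 0 < ν) (hdec : HasRapidSpatialDecay u₀)
    (hs : IsSmoothOnHalfSpace f) (hd : HasRapidSpaceTimeDecay f) :
    ∃ E : ℝ≥0∞, E < ⊤ ∧ ∀ P : Piece ν f u₀, ∀ t ∈ Icc 0 P.τ, ∫⁻ x, ‖P.v t x‖ₑ ^ 2 ≤ E := by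
  obtain ⟨C, hC, H⟩ := tao2011_forced_finiteEnergy_energyBound_holds
  obtain ⟨F, hFt, hF⟩ := clayForce_lintegral_sqrt_energy_le hd
  have hu0 : ∫⁻ x, ‖u₀ x‖ₑ ^ 2 < ⊤ := by
    rw [lintegral_enorm_sq_eq_iteratedFDeriv_zero]
    exact hdec.lintegral_enorm_iteratedFDeriv_sq_lt_top (μ := (volume : Measure _)) 0
  set E : ℝ≥0∞ := C * ((∫⁻ x, ‖u₀ x‖ₑ ^ 2) ^ (1 / 2 : ℝ) + F) ^ 2 with hE
  have hEt : E < ⊤ := by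
    refine ENNReal.mul_lt_top hC (ENNReal.pow_lt_top (ENNReal.add_lt_top.2 ⟨?_, hFt⟩))
    exact ENNReal.rpow_lt_top_of_nonneg (by norm_num) hu0.ne
  refine ⟨E, hEt, fun P t ht => ?_⟩
  have hfs : IsSmoothSpaceTimeOn (Icc 0 P.τ) f := hs.isSmoothSpaceTimeOn_Icc P.τ
  have hfE : ∫⁻ s in Icc 0 P.τ, (∫⁻ x, ‖f s x‖ₑ ^ 2) ^ (1 / 2 : ℝ) < ⊤ := (hF P.τ).trans_lt hFt
  obtain ⟨A, hAt, hA⟩ := P.energy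
  have hE' : ∃ A : ℝ≥0, ∀ s ∈ Icc 0 P.τ, ∫⁻ x, ‖P.v s x‖ₑ ^ 2 ≤ A :=
    ⟨A.toNNReal, fun s hs' => (hA s hs').trans (ENNReal.coe_toNNReal hAt.ne).ge⟩
  obtain ⟨h1, -⟩ := H hν P.τ_pos P.classical hfs hfE hE'
  refine (h1 t ht).trans ?_
  rw [hE, P.initial]
  gcongr
  exact hF P.τ

end ClayEvolution

end Summit.NavierStokesRegularity.FluidComputer

end
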